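import Mathlib
import HarnessLib
import Summits.CriticalPhenomena.Ising3DConformalLimit.Theses.ArmDressing

/-!
# Crux `ArmDressing.ArmExtensionFactorisation` (stmt-CriticalPhenomena-16132) — line `registered` (born `Lines/birth.lean`)

Skeleton registrar `planner-skel-stmt-CriticalPhenomena-16132-0`, 2026-08-17 (BC3 of the Lean birth
certificate); RESHAPED by the line lead `prover-line-stmt-CriticalPhenomena-16132-0`, 2026-08-17
(cycle 1): stub 1 derived from stub 2, stub 2 split into 2a/2b (4 registered stubs). The crux is
FIXED: its decl and signature are the route's (`Theses/ArmDressing.lean`, rank 3, "the 3D substitute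
for RSW circuits, normalisation half"); `ArmExtensionFactorisation_of` below concludes it BY NAME.

## Reshape (cycle 1, line lead)

(R1) The birth skeleton's stub 1 `stub_originKesten` (one universal one-arm Kesten ratio `w` at the
origin) is the `n = 1, c = 0, r = 1, z = 0, a = 1` INSTANCE of stub 2 `stub_multiKesten`:
`Fin (1 + 1) = Fin 2`, `fam 1 δ A B = ![disc δ (A 0), disc δ (B 0)]` (`fin_append_one`),
`CROSS 1 = {R | R 0 1}` (`cross_one`), `η * 1 = η`; a scalar inner family `(ci, ri)` is the constant
`Fin 1`-family. `originKesten_of_multiKesten` is that derivation (kernel-checked, no sorry).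
(R2) Stub 2 `stub_multiKesten` is CUT along its one honest seam into
`stub_ratioLimitExists` (2a: for every admissible inner family and all small `η`, `η'`, the `δ → 0⁺`
limit of the connection-probability RATIO exists — the ratio shadow of crux A `BallConnectivityMoebius`
plus positivity of macroscopic ball-crossing limits) and `stub_kestenForgetting` (2b: one `W` per
configuration to which EVERY eventual version of those limits tends as `η' → 0⁺`, for every admissible
family — Kesten far-field forgetting proper, Panis2025 Open Problem 1 in ratio form);
`multiKesten_of_ratioLimitExists_of_kestenForgetting` composes them (pointwise Hilbert-epsilon choice
of the limit function, `exists_fun_of_eventually_exists`), and `ratioLimitExists_of_multiKesten`,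
`kestenForgetting_of_multiKesten` prove the converse, so `2a ∧ 2b ⟺ stub_multiKesten` and the line is
neither weakened nor strengthened. Registered stubs after cycle 1: `stub_ratioLimitExists`,
`stub_kestenForgetting`, `stub_pointArmScaling`, `stub_centredIdentification` (4 ≤ stubs_max); the
assembly takes these four. Stub statements 3–4 are byte-identical to the birth skeleton; 2a/2b are
stated over stub 2's own `let` header with stub 2's admissibility hypotheses verbatim.

## The cut (ratio limits exist ∣ Kesten forgetting ∣ point-arm scaling ∣ centred identification)

The crux, for `n ≥ 1` points `z_j` in pairwise disjoint closed balls `D_j`, asserts (i) the normalised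
joint point-arm probability `P[z_j^δ ↔ (D_jᶜ)^δ ∀j] / arm1(δ,1)^n → v(z)` locally uniformly, `v` continuous
and positive, and (ii) for all multipliers `a_j > 0` the existence of double-ratio limits `W` (n-point,
outer `D_j`, middle `B(z_j, η a_j)`) and `w` (one-point at the origin, outer `B(0,1)`, middle `B(0,η)`)
that are INDEPENDENT of the family of inner balls shrinking to the points, with `W η / ∏ w(η a_j) → v z`.
Structural facts about the crux AS TYPED that drive the cut:

* the one-point clause for `w` mentions none of `n, c, r, z, a` — one universal `w` serves every
  configuration, and it is the `n = 1` origin instance of the `W`-clause (reshape above);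
* admissible `W`, `w` are determined, eventually near `η = 0⁺`, by ANY single admissible inner family
  (limits in `ℝ` along the `NeBot` filter `𝓝[>] 0` are unique), so the identification
  `W η / ∏ w(η a_j) → v z` need only be asked along the CENTRED families `B̄(z_j,η')`, `B̄(0,η')` — and then
  for EVERY candidate pair `(W, w)` of centred double limits (stub 4), which makes it independent of the
  witness chosen in stub 2.

Stubs (all stated over the crux's own `let` header): `stub_ratioLimitExists` (2a: mesoscopic
connection-ratio limits exist), `stub_kestenForgetting` (2b: ∃ `W` per configuration absorbing every
admissible inner family — at `n = 1` at the origin it is the one-arm IIC ratio `w`),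
`stub_pointArmScaling` (clause (i): scaling functions exist, continuous, positive, locally uniform),
`stub_centredIdentification` (pointwise limit + centred double limits ⇒ factorisation identity).
Assembly `ArmExtensionFactorisation_of`: real proof (stub 2 from 2a+2b, former stub 1 from stub 2,
pointwise limit from local uniformity, admissibility of the centred families along `𝓝[>] 0`,
instantiation), no sorry; `sorry` occurs exactly four times, once inside each `stub_*`.
-/

namespace Summit.CriticalPhenomena.Ising3DConformalLimit.Cruxes.ArmExtensionFactorisation.Birth

open scoped BigOperators Topology
open Filter Set


/-- `Fin.append` of two `Fin 1`-families is the pair `![f 0, g 0]` (as a `Fin 2`-family; `1 + 1 = 2`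
by `rfl`). Used to identify `fam 1 δ A B` with the crux's two-set families. -/
theorem fin_append_one {α : Type*} (f g : Fin 1 → α) : Fin.append f g = ![f 0, g 0] := by
  ext i
  fin_cases i <;> rfl

/-- `CROSS 1 = {R | R 0 1}`: for one inner/outer pair the crossing relation set of the crux is the
single relation `R 0 1` (`Fin.castAdd 1 0 = 0`, `Fin.natAdd 1 0 = 1` by `rfl`). -/
theorem cross_one :
    {R : Fin (1 + 1) → Fin (1 + 1) → Prop | ∀ i : Fin 1, R (Fin.castAdd 1 i) (Fin.natAdd 1 i)} =
      {R | R 0 1} := by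
  ext R
  simp only [Set.mem_setOf_eq, Fin.forall_fin_one]
  rfl

/-- STUB 2a — MESOSCOPIC CONNECTION-RATIO LIMITS EXIST (the existence half of the birth skeleton's
`stub_multiKesten`, cut out by the lead in cycle 1). For `n ≥ 1` pairwise disjoint closed balls
`D_j = B̄(c_j,r_j)`, points `z_j ∈ B(c_j,r_j)`, multipliers `a_j > 0` and EVERY admissible family of inner
closed balls `B̄(cᵢ(η') j, rᵢ(η') j)` shrinking to the `z_j` (points well inside): for all small `η`, for
all small `η'`, the `δ → 0⁺` limit of the ratio `P[innerⱼ ↔ D_jᶜ ∀ j] / P[innerⱼ ↔ B(z_j, η a_j)ᶜ ∀ j]`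
EXISTS. This is the ratio shadow of crux A `BallConnectivityMoebius` (stmt-CriticalPhenomena-16131:
existence of the `δ → 0⁺` limits `lam` of connection laws of generalised-ball families — inner closed
balls and closed exteriors are generalised balls, `CROSS n` is a relation set) PLUS positivity of the
denominator's limit (a macroscopic ball-to-sphere crossing probability of critical FK-Ising stays
bounded away from `0` as `δ → 0`: second-moment / hyperscaling input, open in `d = 3`), and it needs the
`L → ∞` limits behind `Pr` to be genuine (support stmt-CriticalPhenomena-16134 (a)). Why plausibly true:
planar = RSW + convergence to CLE₁₆/₃ (CamiaFeng2025 Lemma 15, Camia2023 §4); 3D = scale invariance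
of the critical FK-Ising cluster ensemble below `d_c = 4`. Size: XL (open). Leans on: the crux's own
`Pr`, `fam`, `CROSS`. -/
theorem stub_ratioLimitExists : open Literature.Probability.LatticeModels Literature.Probability.Percolation Literature.Barriers.CriticalPhenomena Filter Topology in let E3 := EuclideanSpace ℝ (Fin 3); let μ : (L : ℕ) → MeasureTheory.Measure (BondConfig (BoxV 3 L)) := fun L => rcMeasure (boxGraph 3 L) (fkIsingParam (criticalBeta 3)) 2 (boxBoundary 3 L); let PrL : (m : ℕ) → (Fin m → Set (Site 3)) → Set (Fin m → Fin m → Prop) → ℕ → ℝ := fun _ K R L => (μ L).real {ω | (fun i j => ∃ x y : BoxV 3 L, x.1 ∈ K i ∧ y.1 ∈ K j ∧ (openGraph ω).Reachable x y) ∈ R}; let Pr : (m : ℕ) → (Fin m → Set (Site 3)) → Set (Fin m → Fin m → Prop) → ℝ := fun m K R => limUnder atTop (PrL m K R); let mesh : ℝ → Site 3 → E3 := fun δ z => WithLp.toLp 2 fun i : Fin 3 => δ * (z i : ℝ); let disc : ℝ → Set E3 → Set (Site 3) := fun δ A => {x | mesh δ x ∈ A}; let CROSS : (n : ℕ) → Set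 (Fin (n + n) → Fin (n + n) → Prop) := fun n => {R | ∀ i : Fin n, R (Fin.castAdd n i) (Fin.natAdd n i)}; let fam : (n : ℕ) → ℝ → (Fin n → Set E3) → (Fin n → Set E3) → (Fin (n + n) → Set (Site 3)) := fun _ δ A B => Fin.append (fun j => disc δ (A j)) (fun j => disc δ (B j)); ∀ (n : ℕ), 1 ≤ n → ∀ (c : Fin n → E3) (r : Fin n → ℝ), (∀ j, 0 < r j) → (∀ j k, j ≠ k → Disjoint (Metric.closedBall (c j) (r j)) (Metric.closedBall (c k) (r k))) → ∀ z : Fin n → E3, (∀ j, z j ∈ Metric.ball (c j) (r j)) → ∀ a : Fin n → ℝ, (∀ j, 0 < a j) → ∀ (ci : ℝ → Fin n → E3) (ri : ℝ → Fin n → ℝ), (∀ j, Tendsto (fun η' => ri η' j) (𝓝[>] 0) (𝓝 0)) → (∀ᶠ η' in 𝓝[>] 0, ∀ j, 0 < ri η' j ∧ z j ∈ Metric.ball (ci η' j) (ri η' j / 2)) → ∀ᶠ η in 𝓝[>] 0, ∀ᶠ η' in 𝓝[>] 0, ∃ ℓ : ℝ, Tendsto (fun δ => Pr (n + n) (fam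 n δ (fun j => Metric.closedBall (ci η' j) (ri η' j)) (fun j => (Metric.ball (c j) (r j))ᶜ)) (CROSS n) / Pr (n + n) (fam n δ (fun j => Metric.closedBall (ci η' j) (ri η' j)) (fun j => (Metric.ball (z j) (η * a j))ᶜ)) (CROSS n)) (𝓝[>] 0) (𝓝 ℓ) := by
  sorry

/-- STUB 2b — KESTEN FAR-FIELD FORGETTING (the identification half of the birth skeleton's
`stub_multiKesten`, cut out by the lead in cycle 1; Panis2025 Open Problem 1 — the one-arm IIC of
critical FK-Ising in `d = 3` — in RATIO form, for `n` simultaneous arms). For `n ≥ 1`, disjoint `D_j`,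
`z ∈ U`, `a > 0` there is ONE `W : ℝ → ℝ` such that for EVERY admissible inner family and all small
`η`: ANY function `Λ` that is, for all small `η'`, the `δ → 0⁺` limit of the ratio
`P[innerⱼ ↔ D_jᶜ ∀ j] / P[innerⱼ ↔ B(z_j, η a_j)ᶜ ∀ j]` tends to `W η` as the inner radius `η' → 0⁺`
(vacuous where the limits do not exist — existence is stub 2a; where they exist `Λ` is determined
eventually, limits along the `NeBot` filter `𝓝[>] 0` being unique). Content: the far field of an
arm-conditioned critical FK-Ising cluster forgets how the arm starts (uniqueness of the cluster crossing
each annulus `A(η', η a_j)` as `η'/η → 0`, no RSW circuits / no BK at `q = 2`; ratio mixing of the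
arm-conditioned measure, AizenmanDuminilCopinAnnals2021 §6 style). `stub 2a ∧ stub 2b ⟺ stub_multiKesten`
(`multiKesten_of_ratioLimitExists_of_kestenForgetting` below and the converse by uniqueness of limits).
Why plausibly true: planar = Kesten1986 / GarbanPeteSchramm2013 quasi-multiplicativity + CF25 Lemma 15;
3D: open. Size: XL (open). Leans on: the crux's own `Pr`, `fam`, `CROSS`. -/
theorem stub_kestenForgetting : open Literature.Probability.LatticeModels Literature.Probability.Percolation Literature.Barriers.CriticalPhenomena Filter Topology in let E3 := EuclideanSpace ℝ (Fin 3); let μ : (L : ℕ) → MeasureTheory.Measure (BondConfig (BoxV 3 L)) := fun L => rcMeasure (boxGraph 3 L) (fkIsingParam (criticalBeta 3)) 2 (boxBoundary 3 L); let PrL : (m : ℕ) → (Fin m → Set (Site 3)) → Set (Fin m → Fin m → Prop) → ℕ → ℝ := fun _ K R L => (μ L).real {ω | (fun i j => ∃ x y : BoxV 3 L, x.1 ∈ K i ∧ y.1 ∈ K j ∧ (openGraph ω).Reachable x y) ∈ R}; let Pr : (m : ℕ) → (Fin m → Set (Site 3)) → Set (Fin m → Fin m → Prop) → ℝ := fun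 m K R => limUnder atTop (PrL m K R); let mesh : ℝ → Site 3 → E3 := fun δ z => WithLp.toLp 2 fun i : Fin 3 => δ * (z i : ℝ); let disc : ℝ → Set E3 → Set (Site 3) := fun δ A => {x | mesh δ x ∈ A}; let CROSS : (n : ℕ) → Set (Fin (n + n) → Fin (n + n) → Prop) := fun n => {R | ∀ i : Fin n, R (Fin.castAdd n i) (Fin.natAdd n i)}; let fam : (n : ℕ) → ℝ → (Fin n → Set E3) → (Fin n → Set E3) → (Fin (n + n) → Set (Site 3)) := fun _ δ A B => Fin.append (fun j => disc δ (A j)) (fun j => disc δ (B j)); ∀ (n : ℕ), 1 ≤ n → ∀ (c : Fin n → E3) (r : Fin n → ℝ), (∀ j, 0 < r j) → (∀ j k, j ≠ k → Disjoint (Metric.closedBall (c j) (r j)) (Metric.closedBall (c k) (r k))) → ∀ z : Fin n → E3, (∀ j, z j ∈ Metric.ball (c j) (r j)) → ∀ a : Fin n → ℝ, (∀ j, 0 < a j) → ∃ W : ℝ → ℝ, ∀ (ci : ℝ → Fin n → E3) (ri : ℝ → Fin n → ℝ), (∀ j, Tendsto (fun η' => ri η' j) (𝓝[>] 0) (𝓝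 0)) → (∀ᶠ η' in 𝓝[>] 0, ∀ j, 0 < ri η' j ∧ z j ∈ Metric.ball (ci η' j) (ri η' j / 2)) → ∀ᶠ η in 𝓝[>] 0, ∀ Λ : ℝ → ℝ, (∀ᶠ η' in 𝓝[>] 0, Tendsto (fun δ => Pr (n + n) (fam n δ (fun j => Metric.closedBall (ci η' j) (ri η' j)) (fun j => (Metric.ball (c j) (r j))ᶜ)) (CROSS n) / Pr (n + n) (fam n δ (fun j => Metric.closedBall (ci η' j) (ri η' j)) (fun j => (Metric.ball (z j) (η * a j))ᶜ)) (CROSS n)) (𝓝[>] 0) (𝓝 (Λ η'))) → Tendsto Λ (𝓝[>] 0) (𝓝 (W η)) := by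
  sorry

/-- STUB 3 — POINT-ARM SCALING FUNCTIONS (CamiaFeng2025 Lemmas 16–17 transposed; the crux's clause (i)
verbatim). For `n ≥ 1` pairwise disjoint closed balls `D_j`: the joint point-to-domain arm probability
`P[z_j^δ ↔ (D_jᶜ)^δ ∀ j]` divided by the one-arm normalisation `arm1(δ,1)^n` converges LOCALLY UNIFORMLY on
`U = ∏ B(c_j,r_j)` as `δ → 0⁺` to a continuous `v > 0`. Content: existence of the one-arm RATIO limits
(`arm1(δ,ρ)/arm1(δ,1) → ρ^(-Δ)`, the dividend OneArmExponent at `n = 1`), asymptotic independence of the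
`n` arms at mesoscopic scale (mixing) and equicontinuity in `z` (lattice translation + monotonicity in the
domain). Strictly weaker than the crux (no identification (ii)). Why plausibly true: planar = CF25 Thm 4 /
Lemma 17 and Camia2023 Thm 1.4; 3D heuristics `Δ = Δ_σ ≈ 0.518` (PolandRychkovVichi2019); fails above
`d_c = 4` (wired spheres over-magnetise), cf. the crux's why-line. Size: XL (open). -/
theorem stub_pointArmScaling : open Literature.Probability.LatticeModels Literature.Probability.Percolation Literature.Barriers.CriticalPhenomena Filter Topology in let E3 := EuclideanSpace ℝ (Fin 3); let μ : (L : ℕ) → MeasureTheory.Measure (BondConfig (BoxV 3 L)) := fun L => rcMeasure (boxGraph 3 L) (fkIsingParam (criticalBeta 3)) 2 (boxBoundary 3 L); let PrL : (m : ℕ) → (Fin m → Set (Site 3)) → Set (Fin m → Fin m → Prop) → ℕ → ℝ := fun _ K R L => (μ L).real {ω | (fun i j => ∃ x y : BoxV 3 L, x.1 ∈ K i ∧ y.1 ∈ K j ∧ (openGraph ω).Reachable x y) ∈ R}; let Pr : (m : ℕ) → (Fin m → Set (Site 3)) → Set (Fin m → Fin m → Prop) → ℝ := fun m K R => limUnder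 atTop (PrL m K R); let mesh : ℝ → Site 3 → E3 := fun δ z => WithLp.toLp 2 fun i : Fin 3 => δ * (z i : ℝ); let disc : ℝ → Set E3 → Set (Site 3) := fun δ A => {x | mesh δ x ∈ A}; let arm1 : ℝ → ℝ → ℝ := fun δ r => Pr 2 ![{(0 : Site 3)}, disc δ (Metric.ball (0 : E3) r)ᶜ] {R | R 0 1}; let CROSS : (n : ℕ) → Set (Fin (n + n) → Fin (n + n) → Prop) := fun n => {R | ∀ i : Fin n, R (Fin.castAdd n i) (Fin.natAdd n i)}; let pts : (n : ℕ) → ℝ → (Fin n → E3) → (Fin n → Set (Site 3)) := fun _ δ z j => {latticeApprox δ (z j)}; ∀ (n : ℕ), 1 ≤ n → ∀ (c : Fin n → E3) (r : Fin n → ℝ), (∀ j, 0 < r j) → (∀ j k, j ≠ k → Disjoint (Metric.closedBall (c j) (r j)) (Metric.closedBall (c k) (r k))) → ∃ v : (Fin n → E3) → ℝ, ContinuousOn v {z | ∀ j, z j ∈ Metric.ball (c j) (r j)} ∧ (∀ z : Fin n → E3, (∀ j, z j ∈ Metric.ball (c j) (r j)) → 0 < v z) ∧ TendstoLocallyUniformlyOn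 (fun δ z => Pr (n + n) (Fin.append (pts n δ z) (fun j => disc δ (Metric.ball (c j) (r j))ᶜ)) (CROSS n) / (arm1 δ 1) ^ n) v (𝓝[>] 0) {z | ∀ j, z j ∈ Metric.ball (c j) (r j)} := by
  sorry

/-- STUB 4 — CENTRED DOUBLE-RATIO IDENTIFICATION (the factorisation identity, CamiaFeng2025 §3.2.3
eq. for `C(z)` transposed; the crux's clause (ii)-limit, but asked ONLY along the CENTRED inner family
`B̄(z_j, η')` / `B̄(0, η')` and for ANY candidate pair `(W, w)` of double-ratio limits along it). If the
normalised point-arm probability at `z` has a `δ → 0⁺` limit `vz`, and `W`, `w` are the `η' → 0` limits of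
the `δ → 0` limits of the centred ratios `P[B̄(z_j,η') ↔ D_jᶜ ∀j]/P[B̄(z_j,η') ↔ B(z_j,η a_j)ᶜ ∀j]` and
`P[B̄(0,η') ↔ B(0,1)ᶜ]/P[B̄(0,η') ↔ B(0,η)ᶜ]` (for all small `η`), then `W η / ∏_j w (η a_j) → vz` as
`η → 0⁺`. Content: point-start = ball-start for the far field (Kesten), factorisation of the joint
point-to-mesoscopic arm probability into one-arm factors (mixing at separation `≫ η`), lattice translation
of the one-arm factor from `z_j` to `0`, and the cancellation of the microscopic hooking constants in the
ratio. The centred family suffices because admissible `(W, w)` are determined eventually near `0⁺` by any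
one inner family (limits in `ℝ` along `𝓝[>] 0` are unique) — the assembly instantiates stubs 1–2 at the
centred families. Why plausibly true: planar = CF25 Lemmas 15–17 combined (proof of Thm 4, p.16–17);
3D inputs as in stubs 1–2 plus ratio mixing. Size: L–XL (open). -/
theorem stub_centredIdentification : open Literature.Probability.LatticeModels Literature.Probability.Percolation Literature.Barriers.CriticalPhenomena Filter Topology in let E3 := EuclideanSpace ℝ (Fin 3); let μ : (L : ℕ) → MeasureTheory.Measure (BondConfig (BoxV 3 L)) := fun L => rcMeasure (boxGraph 3 L) (fkIsingParam (criticalBeta 3)) 2 (boxBoundary 3 L); let PrL : (m : ℕ) → (Fin m → Set (Site 3)) → Set (Fin m → Fin m → Prop) → ℕ → ℝ := fun _ K R L => (μ L).real {ω | (fun i j => ∃ x y : BoxV 3 L, x.1 ∈ K i ∧ y.1 ∈ K j ∧ (openGraph ω).Reachable x y) ∈ R}; let Pr : (m : ℕ) → (Fin m → Set (Site 3)) → Set (Fin m → Fin m → Prop) → ℝ := fun m K R => limUnder atTop (PrL m K R); let mesh : ℝ → Site 3 → E3 := fun δ z => WithLp.toLp 2 fun i : Fin 3 => δ * (z i : ℝ);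 let disc : ℝ → Set E3 → Set (Site 3) := fun δ A => {x | mesh δ x ∈ A}; let arm1 : ℝ → ℝ → ℝ := fun δ r => Pr 2 ![{(0 : Site 3)}, disc δ (Metric.ball (0 : E3) r)ᶜ] {R | R 0 1}; let CROSS : (n : ℕ) → Set (Fin (n + n) → Fin (n + n) → Prop) := fun n => {R | ∀ i : Fin n, R (Fin.castAdd n i) (Fin.natAdd n i)}; let pts : (n : ℕ) → ℝ → (Fin n → E3) → (Fin n → Set (Site 3)) := fun _ δ z j => {latticeApprox δ (z j)}; let fam : (n : ℕ) → ℝ → (Fin n → Set E3) → (Fin n → Set E3) → (Fin (n + n) → Set (Site 3)) := fun _ δ A B => Fin.append (fun j => disc δ (A j)) (fun j => disc δ (B j)); ∀ (n : ℕ), 1 ≤ n → ∀ (c : Fin n → E3) (r : Fin n → ℝ), (∀ j, 0 < r j) → (∀ j k, j ≠ k → Disjoint (Metric.closedBall (c j) (r j)) (Metric.closedBall (c k) (r k))) → ∀ z : Fin n → E3, (∀ j, z j ∈ Metric.ball (c j) (r j)) → ∀ a : Fin n → ℝ, (∀ j, 0 < a j) → ∀ vz : ℝ, Tendsto (fun δ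 => Pr (n + n) (Fin.append (pts n δ z) (fun j => disc δ (Metric.ball (c j) (r j))ᶜ)) (CROSS n) / (arm1 δ 1) ^ n) (𝓝[>] 0) (𝓝 vz) → ∀ (W w : ℝ → ℝ), (∀ᶠ η in 𝓝[>] 0, ∃ Λ : ℝ → ℝ, (∀ᶠ η' in 𝓝[>] 0, Tendsto (fun δ => Pr (n + n) (fam n δ (fun j => Metric.closedBall (z j) η') (fun j => (Metric.ball (c j) (r j))ᶜ)) (CROSS n) / Pr (n + n) (fam n δ (fun j => Metric.closedBall (z j) η') (fun j => (Metric.ball (z j) (η * a j))ᶜ)) (CROSS n)) (𝓝[>] 0) (𝓝 (Λ η'))) ∧ Tendsto Λ (𝓝[>] 0) (𝓝 (W η))) → (∀ᶠ η in 𝓝[>] 0, ∃ Λ : ℝ → ℝ, (∀ᶠ η' in 𝓝[>] 0, Tendsto (fun δ => Pr 2 ![disc δ (Metric.closedBall (0 : E3) η'), disc δ (Metric.ball (0 : E3) 1)ᶜ] {R | R 0 1} / Pr 2 ![disc δ (Metric.closedBall (0 : E3) η'), disc δ (Metric.ball (0 : E3) η)ᶜ] {R | R 0 1}) (𝓝[>]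 0) (𝓝 (Λ η'))) ∧ Tendsto Λ (𝓝[>] 0) (𝓝 (w η))) → Tendsto (fun η => W η / ∏ j, w (η * a j)) (𝓝[>] 0) (𝓝 vz) := by
  sorry


/-! ## Stub statements as named propositions (verbatim copies, for the assembly signature) -/
namespace Registered

/-- statement of the birth skeleton's former stub `stub_originKesten` (verbatim; no longer a registered stub —
it is DERIVED from `Registered.stub_multiKesten` by `originKesten_of_multiKesten` below). -/
abbrev stub_originKesten : Prop := open Literature.Probability.LatticeModels Literature.Probability.Percolation Literature.Barriers.CriticalPhenomena Filter Topology in let E3 := EuclideanSpace ℝ (Fin 3); let μ : (L : ℕ) → MeasureTheory.Measure (BondConfig (BoxV 3 L)) := fun L => rcMeasure (boxGraph 3 L) (fkIsingParam (criticalBeta 3)) 2 (boxBoundary 3 L); let PrL : (m : ℕ) → (Fin m → Set (Site 3)) → Set (Fin m → Fin m → Prop) → ℕ → ℝ := fun _ K R L => (μ L).real {ω | (fun i j => ∃ x y : BoxV 3 L, x.1 ∈ K i ∧ y.1 ∈ K j ∧ (openGraph ω).Reachable x y) ∈ R}; let Pr : (m : ℕ) → (Fin m → Set (Site 3)) → Set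 (Fin m → Fin m → Prop) → ℝ := fun m K R => limUnder atTop (PrL m K R); let mesh : ℝ → Site 3 → E3 := fun δ z => WithLp.toLp 2 fun i : Fin 3 => δ * (z i : ℝ); let disc : ℝ → Set E3 → Set (Site 3) := fun δ A => {x | mesh δ x ∈ A}; ∃ w : ℝ → ℝ, ∀ (ci : ℝ → E3) (ri : ℝ → ℝ), Tendsto ri (𝓝[>] 0) (𝓝 0) → (∀ᶠ η' in 𝓝[>] 0, 0 < ri η' ∧ (0 : E3) ∈ Metric.ball (ci η') (ri η' / 2)) → ∀ᶠ η in 𝓝[>] 0, ∃ Λ : ℝ → ℝ, (∀ᶠ η' in 𝓝[>] 0, Tendsto (fun δ => Pr 2 ![disc δ (Metric.closedBall (ci η') (ri η')), disc δ (Metric.ball (0 : E3) 1)ᶜ] {R | R 0 1} / Pr 2 ![disc δ (Metric.closedBall (ci η') (ri η')), disc δ (Metric.ball (0 : E3) η)ᶜ] {R | R 0 1}) (𝓝[>] 0) (𝓝 (Λ η'))) ∧ Tendsto Λ (𝓝[>] 0) (𝓝 (w η))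

/-- registered statement of `stub_ratioLimitExists` (verbatim). -/
abbrev stub_ratioLimitExists : Prop := open Literature.Probability.LatticeModels Literature.Probability.Percolation Literature.Barriers.CriticalPhenomena Filter Topology in let E3 := EuclideanSpace ℝ (Fin 3); let μ : (L : ℕ) → MeasureTheory.Measure (BondConfig (BoxV 3 L)) := fun L => rcMeasure (boxGraph 3 L) (fkIsingParam (criticalBeta 3)) 2 (boxBoundary 3 L); let PrL : (m : ℕ) → (Fin m → Set (Site 3)) → Set (Fin m → Fin m → Prop) → ℕ → ℝ := fun _ K R L => (μ L).real {ω | (fun i j => ∃ x y : BoxV 3 L, x.1 ∈ K i ∧ y.1 ∈ K j ∧ (openGraph ω).Reachable x y) ∈ R}; let Pr : (m : ℕ) → (Fin m → Set (Site 3)) → Set (Fin m → Fin m → Prop) → ℝ := fun m K R => limUnder atTop (PrL m K R); let mesh : ℝ → Site 3 → E3 := fun δ z => WithLp.toLp 2 fun i : Fin 3 => δ * (z i : ℝ); let disc : ℝ → Set E3 → Set (Site 3) := fun δ A => {x | mesh δ x ∈ A}; let CROSS : (n : ℕ) → Set (Fin (n + n) → Fin (n + n) → Prop) := fun n => {R |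 ∀ i : Fin n, R (Fin.castAdd n i) (Fin.natAdd n i)}; let fam : (n : ℕ) → ℝ → (Fin n → Set E3) → (Fin n → Set E3) → (Fin (n + n) → Set (Site 3)) := fun _ δ A B => Fin.append (fun j => disc δ (A j)) (fun j => disc δ (B j)); ∀ (n : ℕ), 1 ≤ n → ∀ (c : Fin n → E3) (r : Fin n → ℝ), (∀ j, 0 < r j) → (∀ j k, j ≠ k → Disjoint (Metric.closedBall (c j) (r j)) (Metric.closedBall (c k) (r k))) → ∀ z : Fin n → E3, (∀ j, z j ∈ Metric.ball (c j) (r j)) → ∀ a : Fin n → ℝ, (∀ j, 0 < a j) → ∀ (ci : ℝ → Fin n → E3) (ri : ℝ → Fin n → ℝ), (∀ j, Tendsto (fun η' => ri η' j) (𝓝[>] 0) (𝓝 0)) → (∀ᶠ η' in 𝓝[>] 0, ∀ j, 0 < ri η' j ∧ z j ∈ Metric.ball (ci η' j) (ri η' j / 2)) → ∀ᶠ η in 𝓝[>] 0, ∀ᶠ η' in 𝓝[>] 0, ∃ ℓ : ℝ, Tendsto (fun δ => Pr (n + n) (fam n δ (fun j => Metric.closedBall (ci η' j) (ri η' j)) (fun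 j => (Metric.ball (c j) (r j))ᶜ)) (CROSS n) / Pr (n + n) (fam n δ (fun j => Metric.closedBall (ci η' j) (ri η' j)) (fun j => (Metric.ball (z j) (η * a j))ᶜ)) (CROSS n)) (𝓝[>] 0) (𝓝 ℓ)

/-- registered statement of `stub_kestenForgetting` (verbatim). -/
abbrev stub_kestenForgetting : Prop := open Literature.Probability.LatticeModels Literature.Probability.Percolation Literature.Barriers.CriticalPhenomena Filter Topology in let E3 := EuclideanSpace ℝ (Fin 3); let μ : (L : ℕ) → MeasureTheory.Measure (BondConfig (BoxV 3 L)) := fun L => rcMeasure (boxGraph 3 L) (fkIsingParam (criticalBeta 3)) 2 (boxBoundary 3 L); let PrL : (m : ℕ) → (Fin m → Set (Site 3)) → Set (Fin m → Fin m → Prop) → ℕ → ℝ := fun _ K R L => (μ L).real {ω | (fun i j => ∃ x y : BoxV 3 L, x.1 ∈ K i ∧ y.1 ∈ K j ∧ (openGraph ω).Reachable x y) ∈ R}; let Pr : (m : ℕ) → (Fin m → Set (Site 3)) → Set (Fin m → Fin m → Prop) → ℝ := fun m K R => limUnder atTop (PrL m K R); let mesh : ℝ → Site 3 → E3 := fun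 δ z => WithLp.toLp 2 fun i : Fin 3 => δ * (z i : ℝ); let disc : ℝ → Set E3 → Set (Site 3) := fun δ A => {x | mesh δ x ∈ A}; let CROSS : (n : ℕ) → Set (Fin (n + n) → Fin (n + n) → Prop) := fun n => {R | ∀ i : Fin n, R (Fin.castAdd n i) (Fin.natAdd n i)}; let fam : (n : ℕ) → ℝ → (Fin n → Set E3) → (Fin n → Set E3) → (Fin (n + n) → Set (Site 3)) := fun _ δ A B => Fin.append (fun j => disc δ (A j)) (fun j => disc δ (B j)); ∀ (n : ℕ), 1 ≤ n → ∀ (c : Fin n → E3) (r : Fin n → ℝ), (∀ j, 0 < r j) → (∀ j k, j ≠ k → Disjoint (Metric.closedBall (c j) (r j)) (Metric.closedBall (c k) (r k))) → ∀ z : Fin n → E3, (∀ j, z j ∈ Metric.ball (c j) (r j)) → ∀ a : Fin n → ℝ, (∀ j, 0 < a j) → ∃ W : ℝ → ℝ, ∀ (ci : ℝ → Fin n → E3) (ri : ℝ → Fin n → ℝ), (∀ j, Tendsto (fun η' => ri η' j) (𝓝[>] 0) (𝓝 0)) → (∀ᶠ η' in 𝓝[>] 0, ∀ j, 0 < ri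 η' j ∧ z j ∈ Metric.ball (ci η' j) (ri η' j / 2)) → ∀ᶠ η in 𝓝[>] 0, ∀ Λ : ℝ → ℝ, (∀ᶠ η' in 𝓝[>] 0, Tendsto (fun δ => Pr (n + n) (fam n δ (fun j => Metric.closedBall (ci η' j) (ri η' j)) (fun j => (Metric.ball (c j) (r j))ᶜ)) (CROSS n) / Pr (n + n) (fam n δ (fun j => Metric.closedBall (ci η' j) (ri η' j)) (fun j => (Metric.ball (z j) (η * a j))ᶜ)) (CROSS n)) (𝓝[>] 0) (𝓝 (Λ η'))) → Tendsto Λ (𝓝[>] 0) (𝓝 (W η))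

/-- statement of the birth skeleton's stub `stub_multiKesten` (verbatim; no longer a registered stub — it is
DERIVED from `Registered.stub_ratioLimitExists` and `Registered.stub_kestenForgetting` by
`multiKesten_of_ratioLimitExists_of_kestenForgetting` below). -/
abbrev stub_multiKesten : Prop := open Literature.Probability.LatticeModels Literature.Probability.Percolation Literature.Barriers.CriticalPhenomena Filter Topology in let E3 := EuclideanSpace ℝ (Fin 3); let μ : (L : ℕ) → MeasureTheory.Measure (BondConfig (BoxV 3 L)) := fun L => rcMeasure (boxGraph 3 L) (fkIsingParam (criticalBeta 3)) 2 (boxBoundary 3 L); let PrL : (m : ℕ) → (Fin m → Set (Site 3)) → Set (Fin m → Fin m → Prop) → ℕ → ℝ := fun _ K R L => (μ L).real {ω | (fun i j => ∃ x y : BoxV 3 L, x.1 ∈ K i ∧ y.1 ∈ K j ∧ (openGraph ω).Reachable x y) ∈ R}; let Pr : (m : ℕ) → (Fin m → Set (Site 3)) → Set (Fin m → Fin m → Prop) → ℝ := fun m K R => limUnder atTop (PrL m K R); let mesh : ℝ → Site 3 → E3 := fun δ z => WithLp.toLp 2 fun i : Fin 3 => δ * (z i : ℝ); let disc : ℝ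 → Set E3 → Set (Site 3) := fun δ A => {x | mesh δ x ∈ A}; let CROSS : (n : ℕ) → Set (Fin (n + n) → Fin (n + n) → Prop) := fun n => {R | ∀ i : Fin n, R (Fin.castAdd n i) (Fin.natAdd n i)}; let fam : (n : ℕ) → ℝ → (Fin n → Set E3) → (Fin n → Set E3) → (Fin (n + n) → Set (Site 3)) := fun _ δ A B => Fin.append (fun j => disc δ (A j)) (fun j => disc δ (B j)); ∀ (n : ℕ), 1 ≤ n → ∀ (c : Fin n → E3) (r : Fin n → ℝ), (∀ j, 0 < r j) → (∀ j k, j ≠ k → Disjoint (Metric.closedBall (c j) (r j)) (Metric.closedBall (c k) (r k))) → ∀ z : Fin n → E3, (∀ j, z j ∈ Metric.ball (c j) (r j)) → ∀ a : Fin n → ℝ, (∀ j, 0 < a j) → ∃ W : ℝ → ℝ, ∀ (ci : ℝ → Fin n → E3) (ri : ℝ → Fin n → ℝ), (∀ j, Tendsto (fun η' => ri η' j) (𝓝[>] 0) (𝓝 0)) → (∀ᶠ η' in 𝓝[>] 0, ∀ j, 0 < ri η' j ∧ z j ∈ Metric.ball (ci η' j) (ri η' j / 2)) → ∀ᶠ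 η in 𝓝[>] 0, ∃ Λ : ℝ → ℝ, (∀ᶠ η' in 𝓝[>] 0, Tendsto (fun δ => Pr (n + n) (fam n δ (fun j => Metric.closedBall (ci η' j) (ri η' j)) (fun j => (Metric.ball (c j) (r j))ᶜ)) (CROSS n) / Pr (n + n) (fam n δ (fun j => Metric.closedBall (ci η' j) (ri η' j)) (fun j => (Metric.ball (z j) (η * a j))ᶜ)) (CROSS n)) (𝓝[>] 0) (𝓝 (Λ η'))) ∧ Tendsto Λ (𝓝[>] 0) (𝓝 (W η))

/-- registered statement of `stub_pointArmScaling` (verbatim). -/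
abbrev stub_pointArmScaling : Prop := open Literature.Probability.LatticeModels Literature.Probability.Percolation Literature.Barriers.CriticalPhenomena Filter Topology in let E3 := EuclideanSpace ℝ (Fin 3); let μ : (L : ℕ) → MeasureTheory.Measure (BondConfig (BoxV 3 L)) := fun L => rcMeasure (boxGraph 3 L) (fkIsingParam (criticalBeta 3)) 2 (boxBoundary 3 L); let PrL : (m : ℕ) → (Fin m → Set (Site 3)) → Set (Fin m → Fin m → Prop) → ℕ → ℝ := fun _ K R L => (μ L).real {ω | (fun i j => ∃ x y : BoxV 3 L, x.1 ∈ K i ∧ y.1 ∈ K j ∧ (openGraph ω).Reachable x y) ∈ R}; let Pr : (m : ℕ) → (Fin m → Set (Site 3)) → Set (Fin m → Fin m → Prop) → ℝ := fun m K R => limUnder atTop (PrL m K R); let mesh : ℝ → Site 3 → E3 := fun δ z => WithLp.toLp 2 fun i : Fin 3 => δ * (z i : ℝ); let disc : ℝ → Set E3 → Set (Site 3) := fun δ A => {x | mesh δ x ∈ A}; let arm1 : ℝ → ℝ → ℝ := fun δ r => Pr 2 ![{(0 : Site 3)}, disc δ (Metric.ball (0 : E3) r)ᶜ] {R | R 0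 1}; let CROSS : (n : ℕ) → Set (Fin (n + n) → Fin (n + n) → Prop) := fun n => {R | ∀ i : Fin n, R (Fin.castAdd n i) (Fin.natAdd n i)}; let pts : (n : ℕ) → ℝ → (Fin n → E3) → (Fin n → Set (Site 3)) := fun _ δ z j => {latticeApprox δ (z j)}; ∀ (n : ℕ), 1 ≤ n → ∀ (c : Fin n → E3) (r : Fin n → ℝ), (∀ j, 0 < r j) → (∀ j k, j ≠ k → Disjoint (Metric.closedBall (c j) (r j)) (Metric.closedBall (c k) (r k))) → ∃ v : (Fin n → E3) → ℝ, ContinuousOn v {z | ∀ j, z j ∈ Metric.ball (c j) (r j)} ∧ (∀ z : Fin n → E3, (∀ j, z j ∈ Metric.ball (c j) (r j)) → 0 < v z) ∧ TendstoLocallyUniformlyOn (fun δ z => Pr (n + n) (Fin.append (pts n δ z) (fun j => disc δ (Metric.ball (c j) (r j))ᶜ)) (CROSS n) / (arm1 δ 1) ^ n) v (𝓝[>] 0) {z | ∀ j, z j ∈ Metric.ball (c j) (r j)}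

/-- registered statement of `stub_centredIdentification` (verbatim). -/
abbrev stub_centredIdentification : Prop := open Literature.Probability.LatticeModels Literature.Probability.Percolation Literature.Barriers.CriticalPhenomena Filter Topology in let E3 := EuclideanSpace ℝ (Fin 3); let μ : (L : ℕ) → MeasureTheory.Measure (BondConfig (BoxV 3 L)) := fun L => rcMeasure (boxGraph 3 L) (fkIsingParam (criticalBeta 3)) 2 (boxBoundary 3 L); let PrL : (m : ℕ) → (Fin m → Set (Site 3)) → Set (Fin m → Fin m → Prop) → ℕ → ℝ := fun _ K R L => (μ L).real {ω | (fun i j => ∃ x y : BoxV 3 L, x.1 ∈ K i ∧ y.1 ∈ K j ∧ (openGraph ω).Reachable x y) ∈ R}; let Pr : (m : ℕ) → (Fin m → Set (Site 3)) → Set (Fin m → Fin m → Prop) → ℝ := fun m K R => limUnder atTop (PrL m K R); let mesh : ℝ → Site 3 → E3 := fun δ z => WithLp.toLp 2 fun i : Fin 3 => δ * (z i : ℝ); let disc : ℝ → Set E3 → Set (Site 3) := fun δ A => {x | mesh δ x ∈ A}; let arm1 : ℝ → ℝ → ℝ := fun δ r => Pr 2 ![{(0 : Site 3)}, disc δ (Metric.ball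 (0 : E3) r)ᶜ] {R | R 0 1}; let CROSS : (n : ℕ) → Set (Fin (n + n) → Fin (n + n) → Prop) := fun n => {R | ∀ i : Fin n, R (Fin.castAdd n i) (Fin.natAdd n i)}; let pts : (n : ℕ) → ℝ → (Fin n → E3) → (Fin n → Set (Site 3)) := fun _ δ z j => {latticeApprox δ (z j)}; let fam : (n : ℕ) → ℝ → (Fin n → Set E3) → (Fin n → Set E3) → (Fin (n + n) → Set (Site 3)) := fun _ δ A B => Fin.append (fun j => disc δ (A j)) (fun j => disc δ (B j)); ∀ (n : ℕ), 1 ≤ n → ∀ (c : Fin n → E3) (r : Fin n → ℝ), (∀ j, 0 < r j) → (∀ j k, j ≠ k → Disjoint (Metric.closedBall (c j) (r j)) (Metric.closedBall (c k) (r k))) → ∀ z : Fin n → E3, (∀ j, z j ∈ Metric.ball (c j) (r j)) → ∀ a : Fin n → ℝ, (∀ j, 0 < a j) → ∀ vz : ℝ, Tendsto (fun δ => Pr (n + n) (Fin.append (pts n δ z) (fun j => disc δ (Metric.ball (c j) (r j))ᶜ)) (CROSS n) / (arm1 δ 1) ^ n) (𝓝[>] 0) (𝓝 vz) → ∀ (W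 w : ℝ → ℝ), (∀ᶠ η in 𝓝[>] 0, ∃ Λ : ℝ → ℝ, (∀ᶠ η' in 𝓝[>] 0, Tendsto (fun δ => Pr (n + n) (fam n δ (fun j => Metric.closedBall (z j) η') (fun j => (Metric.ball (c j) (r j))ᶜ)) (CROSS n) / Pr (n + n) (fam n δ (fun j => Metric.closedBall (z j) η') (fun j => (Metric.ball (z j) (η * a j))ᶜ)) (CROSS n)) (𝓝[>] 0) (𝓝 (Λ η'))) ∧ Tendsto Λ (𝓝[>] 0) (𝓝 (W η))) → (∀ᶠ η in 𝓝[>] 0, ∃ Λ : ℝ → ℝ, (∀ᶠ η' in 𝓝[>] 0, Tendsto (fun δ => Pr 2 ![disc δ (Metric.closedBall (0 : E3) η'), disc δ (Metric.ball (0 : E3) 1)ᶜ] {R | R 0 1} / Pr 2 ![disc δ (Metric.closedBall (0 : E3) η'), disc δ (Metric.ball (0 : E3) η)ᶜ] {R | R 0 1}) (𝓝[>] 0) (𝓝 (Λ η'))) ∧ Tendsto Λ (𝓝[>] 0) (𝓝 (w η))) → Tendsto (fun η => W η / ∏ j, w (η * a j)) (𝓝[>] 0) (𝓝 vz)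

end Registered

/-- Choice along an eventual existence statement: if eventually (along `l`) some witness exists, a
witness FUNCTION exists eventually (Hilbert epsilon pointwise). Used to assemble the limit function `Λ` of
`stub_multiKesten` from the pointwise existence of stub 2a. -/
theorem exists_fun_of_eventually_exists {α β : Type*} [Nonempty β] {l : Filter α} {p : α → β → Prop}
    (h : ∀ᶠ x in l, ∃ y, p x y) : ∃ f : α → β, ∀ᶠ x in l, p x (f x) :=
  ⟨fun x => Classical.epsilon (p x), h.mono fun _ hx => Classical.epsilon_spec hx⟩

/-- FORMER STUB 2, NOW COMPOSED — n-POINT KESTEN DECOUPLING WITH OUTER DOMAINS (CamiaFeng2025 Lemma 15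
transposed: the inner-family-independent double limit `W`) from its two halves: stub 2a gives, for every
admissible inner family and all small `η`, `η'`, the existence of the `δ → 0⁺` ratio limits; choosing them
as a function `Λ` of `η'` (`exists_fun_of_eventually_exists`), stub 2b sends `Λ` to `W η` as `η' → 0⁺`. -/
theorem multiKesten_of_ratioLimitExists_of_kestenForgetting (hE : Registered.stub_ratioLimitExists)
    (hK : Registered.stub_kestenForgetting) : Registered.stub_multiKesten := by
  intro n hn c r hr hd z hz a ha
  obtain ⟨W, hW⟩ := hK n hn c r hr hd z hz a ha
  refine ⟨W, fun ci ri hri hin => ?_⟩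
  filter_upwards [hE n hn c r hr hd z hz a ha ci ri hri hin, hW ci ri hri hin] with η h1 h2
  obtain ⟨Λ, hΛ⟩ := exists_fun_of_eventually_exists h1
  exact ⟨Λ, hΛ, h2 Λ hΛ⟩


/-- Converse bookkeeping (certifies that the cycle-1 split does not strengthen the line): the birth
stub `stub_multiKesten` implies stub 2a — the limits it produces witness existence. -/
theorem ratioLimitExists_of_multiKesten (h : Registered.stub_multiKesten) :
    Registered.stub_ratioLimitExists := by
  intro n hn c r hr hd z hz a ha ci ri hri hin
  obtain ⟨W, hW⟩ := h n hn c r hr hd z hz a ha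
  filter_upwards [hW ci ri hri hin] with η ⟨Λ, hΛ, _⟩
  exact hΛ.mono fun η' h' => ⟨Λ η', h'⟩

/-- Converse bookkeeping: the birth stub `stub_multiKesten` implies stub 2b — any eventual version `Λ`
of the ratio limits agrees eventually with the one it produces (limits in `ℝ` along the `NeBot` filter
`𝓝[>] 0` are unique), hence has the same limit `W η` (`Filter.Tendsto.congr'`). So
`stub_multiKesten ⟺ stub_ratioLimitExists ∧ stub_kestenForgetting`. -/
theorem kestenForgetting_of_multiKesten (h : Registered.stub_multiKesten) :
    Registered.stub_kestenForgetting := by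
  intro n hn c r hr hd z hz a ha
  obtain ⟨W, hW⟩ := h n hn c r hr hd z hz a ha
  refine ⟨W, fun ci ri hri hin => ?_⟩
  filter_upwards [hW ci ri hri hin] with η ⟨Λ₀, hΛ₀, hlim⟩ Λ hΛ
  refine hlim.congr' ?_
  filter_upwards [hΛ₀, hΛ] with η' h0 h1
  exact tendsto_nhds_unique h0 h1

/-- FORMER STUB 1, NOW DERIVED — ONE-ARM KESTEN RATIO AT THE ORIGIN from the n-point Kesten decoupling:
`Registered.stub_originKesten` (one universal `w : ℝ → ℝ` such that for every family of inner closed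
balls shrinking to the origin with the origin well inside, for all small `η` the `δ → 0` limits `Λ(η')`
of `P[inner ↔ B(0,1)ᶜ] / P[inner ↔ B(0,η)ᶜ]` exist for small `η'` and tend to `w η`) is
`Registered.stub_multiKesten` at `n = 1`, `c = 0`, `r = 1` (the pairwise-disjointness hypothesis is vacuous
on `Fin 1`), `z = 0 ∈ B(0,1)`, `a = 1`: take `w := W`; a scalar inner family `(ci, ri)` is fed in as the
constant `Fin 1`-family, and `fam 1 δ A B = ![disc δ (A 0), disc δ (B 0)]` (`fin_append_one`),
`CROSS 1 = {R | R 0 1}` (`cross_one`), `η * 1 = η` turn the `W`-clause into the `w`-clause verbatim. -/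
theorem originKesten_of_multiKesten (h2 : Registered.stub_multiKesten) :
    Registered.stub_originKesten := by
  obtain ⟨W, hW⟩ := h2 1 le_rfl (fun _ => 0) (fun _ => 1) (fun _ => one_pos)
    (fun j k hjk => absurd (Subsingleton.elim j k) hjk) (fun _ => 0) (fun _ => by simp) (fun _ => 1)
    (fun _ => one_pos)
  refine ⟨W, fun ci ri hri hin => ?_⟩
  have h := hW (fun η' _ => ci η') (fun η' _ => ri η') (fun _ => hri) (hin.mono fun η' h _ => h)
  simpa only [fin_append_one, cross_one, mul_one] using h

/-- ASSEMBLY (kernel-checked, no sorry): the three stubs imply the crux, literally the route decl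
`Summit.CriticalPhenomena.Ising3DConformalLimit.Theses.ArmDressing.ArmExtensionFactorisation`.
Clause (i) is stub 3; for clause (ii) at `(z, a)`: `w` from `originKesten_of_multiKesten h2` (one
universal `w`, the `n = 1` origin instance of stub 2), `W` from stub 2, the pointwise limit `v z` of the
normalised point-arm probability is extracted from the locally uniform convergence of stub 3
(`TendstoLocallyUniformlyOn.tendsto_at`), the `W`/`w` clauses are instantiated at the CENTRED inner
families `B̄(0,η')`, `B̄(z_j,η')` (admissible: `η' → 0` along `𝓝[>] 0`, and `η' > 0` eventually there,
so the centres are well inside), and stub 4 identifies `W η / ∏ w (η a_j) → v z`. -/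
theorem ArmExtensionFactorisation_of (h2a : Registered.stub_ratioLimitExists)
    (h2b : Registered.stub_kestenForgetting) (h3 : Registered.stub_pointArmScaling)
    (h4 : Registered.stub_centredIdentification) :
    Summit.CriticalPhenomena.Ising3DConformalLimit.Theses.ArmDressing.ArmExtensionFactorisation := by
  have h2 : Registered.stub_multiKesten := multiKesten_of_ratioLimitExists_of_kestenForgetting h2a h2b
  have h1 : Registered.stub_originKesten := originKesten_of_multiKesten h2
  -- (the crux's `let` header is zeta-reduced by `intro`: the goal starts at `∀ n`)
  intro n hn c r hr hd
  obtain ⟨v, hvc, hvp, hvu⟩ := h3 n hn c r hr hd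
  refine ⟨v, hvc, hvp, hvu, ?_⟩
  intro z hz a ha
  obtain ⟨w, hw⟩ := h1
  obtain ⟨W, hW⟩ := h2 n hn c r hr hd z hz a ha
  -- pointwise limit of the normalised point-arm probability at `z`, from locally uniform convergence
  have hpt := hvu.tendsto_at hz
  -- the centred inner families are admissible
  have hid : Tendsto (fun η' : ℝ => η') (𝓝[>] (0:ℝ)) (𝓝 0) :=
    tendsto_nhdsWithin_of_tendsto_nhds tendsto_id
  have hpos : ∀ᶠ η' in 𝓝[>] (0:ℝ), 0 < η' :=
    eventually_mem_nhdsWithin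
  have hWc := hW (fun _ j => z j) (fun η' _ => η') (fun _ => hid)
    (hpos.mono fun η' hη' j => ⟨hη', Metric.mem_ball_self (half_pos hη')⟩)
  have hwc := hw (fun _ => (0 : EuclideanSpace ℝ (Fin 3))) (fun η' => η') hid
    (hpos.mono fun η' hη' => ⟨hη', Metric.mem_ball_self (half_pos hη')⟩)
  exact ⟨W, w, hW, hw, h4 n hn c r hr hd z hz a ha (v z) hpt W w hWc hwc⟩

/-- The same assembly with the registered `stub_*` theorems plugged in (sorries only inside `stub_*`;
checks that the `Registered` aliases are the stub statements). -/
theorem ArmExtensionFactorisation_of_stubs :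
    Summit.CriticalPhenomena.Ising3DConformalLimit.Theses.ArmDressing.ArmExtensionFactorisation :=
  ArmExtensionFactorisation_of stub_ratioLimitExists stub_kestenForgetting stub_pointArmScaling
    stub_centredIdentification

end Summit.CriticalPhenomena.Ising3DConformalLimit.Cruxes.ArmExtensionFactorisation.Birth
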